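import Summits.CriticalPhenomena.Ising3DConformalLimit.Theorems.CoerciveSharpnessPhiCoerciveDichotomy
import Summits.CriticalPhenomena.Ising3DConformalLimit.Theorems.CoerciveSharpnessPhiCoerciveHoleCapacityFlux
import Summits.CriticalPhenomena.Ising3DConformalLimit.Theorems.CoerciveSharpnessPhiCoerciveFluxCreation
import Summits.CriticalPhenomena.Ising3DConformalLimit.Theorems.CoerciveSharpnessPhiCoerciveLowCoordinationCreation
import Summits.CriticalPhenomena.Ising3DConformalLimit.Theorems.CoerciveSharpnessPhiCoerciveBoxFluxUpper

/-!
# SKELETON of line `box-superset` for the crux `CoerciveSharpness.PhiCoercive` (stmt-CriticalPhenomena-18196)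
# — lead's version after wave 2 (prover-line-stmt-CriticalPhenomena-18196-0, 2026-08-17, cycle 1)

`PhiCoercive` (`φ(S) = β_c Σ_{x∈S} #{y∉S : y∼x} ⟨σ₀σ_x⟩^free_{S,β_c} ≥ c m^κ` for every finite
`S ⊇ Λ_m`) ⇐ `BoxCoercive` (growth on boxes — the surface exponent `1 − η_⊥ > 0` on `ℤ³`,
OPEN PROBLEM) ∧ `SupersetStable` (every finite superset of `Λ_m` radiates `≥ c'·φ(Λ_r)` for some
`r ≥ m`; by the dichotomy only its growth-regime case has content — shape universality of the
boundary flux, also beyond present tools).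

LANDED tree modules of this line (all `namespace …Cruxes.PhiCoercive.BoxSuperset`, `--supports` the crux):
* `Theorems/CoerciveSharpnessPhiCoerciveSplit.lean` (p160158) — vocabulary `phiC`, pieces `BoxCoercive`,
  `SupersetStable`, glue `PhiCoercive_of` / `PhiCoercive_of_subs`, `one_le_phiC` (κ = 0 shadow),
  `phiC_ge_inner` (GKS exposure);
* `…Dichotomy.lean` (p163048) — `supersetStable_of_not_tendsto`, `stub_supersetStable_of_growth`,
  `boxFlux_tendsto_of_boxCoercive`;
* `…HoleCapacity.lean` (p161855) — `stub_holeCapacityPointwise`: `u_Λ(a,x) − u_S(a,x) ≤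
  β Σ_{h∈Λ∖S} Σ_{y∼h, y∈Λ} [u_Λ(a,h)u_Λ(y,x) + u_Λ(a,y)u_Λ(h,x)]` (Lebowitz + coupling path);
* `…HoleCapacityFlux.lean` (p162420) — `stub_holeCapacityFlux`: `φ(S) ≥ φ(Λ) − β Σ_{holes} n_Λ u_Λ(0,h)
  − β Σ_{h} Σ_{y∼h} [u_Λ(0,h) Φ_Λ(y) + u_Λ(0,y) Φ_Λ(h)]` (the capacity jaw of SupersetStable);
* `…FluxCreation.lean` (p161214) — `stub_fluxCreationIdentity` (discrete Gauss: `Σ n_S u = Σ (6u − Σ_{nbrs in S} u)`);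
* `…FreeHeatBath.lean` (p161383) — `stub_freeHeatBath` (one-site DLR identity, free b.c.);
* `…LowCoordinationCreation.lean` (p162916) — `stub_lowCoordinationCreation`: at a site with `≤ 4`
  neighbours in `S` whose mutual correlations are `≤ 1/3`, `u(x) ≥ (tanh 4β / 4)·Σ_{y∼x,y∈S} u(y)`
  (creation: `tanh(4β_c)/4 > 1/6` numerically) — the first genuinely non-Gaussian local inequality here;
* `…BoxFluxUpper.lean` (p161317) — `stub_boxFluxUpper`: `φ(Λ_n) ≤ C n` (κ ≤ 1).

Disproof.lean (cdisprove c1): crux RESISTS; `Negative/`: `gaussPhi_eq_one` (Gaussian flux ≡ 1 — any proof of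
`stub_boxCoercive` must use a non-Gaussian input, e.g. the creation inequality above), `phiC_box_le_linear`,
`phiCoercive_false_without_box`, `phiCoercive_false_subcritical`; no `stub_*_false`.

Open stubs: `stub_boxCoercive` (open problem), `stub_supersetStableInGrowth` (open-problem-level; sharpest
sufficient lemma `CollarExposure`, see the worker scratch `work/stubs/SupersetStableInGrowth_scratch_sigs.lean`).
-/

noncomputable section

namespace Summit.CriticalPhenomena.Ising3DConformalLimit.Cruxes.PhiCoercive.BoxSuperset

open scoped BigOperators
open Finset Filter
open Literature.Probability.LatticeModels
open Summit.CriticalPhenomena.Ising3DConformalLimit.Theses.CoerciveSharpness (PhiCoercive)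

/-! ## Registered composition stubs and the line's closing of the crux -/

/-- **stub (crux, open-problem): coercivity on boxes** `∃ κ c > 0, ∀ m ≥ 1, c m^κ ≤ φ_{β_c}(Λ_m)`. -/
theorem stub_boxCoercive : BoxCoercive := by
  sorry

/-- **stub (crux, open-problem-level / refutable): superset stability IN THE GROWTH REGIME** — the only
regime in which it has content (`supersetStable_of_not_tendsto`). -/
theorem stub_supersetStableInGrowth :
    Tendsto (fun r : ℕ => phiC (box 3 r)) atTop atTop → SupersetStable := by
  sorry

/-- `SupersetStable` from the reshaped stub and the landed dichotomy glue. -/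
theorem supersetStable_proof : SupersetStable :=
  stub_supersetStable_of_growth stub_supersetStableInGrowth

/-- The line closes the crux BY NAME from its two stubs (glue `PhiCoercive_of`, landed p160158). -/
theorem PhiCoercive_proof : PhiCoercive := PhiCoercive_of stub_boxCoercive supersetStable_proof

end Summit.CriticalPhenomena.Ising3DConformalLimit.Cruxes.PhiCoercive.BoxSuperset

end
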